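/-
Copyright (c) 2026. All rights reserved.
Released under Apache 2.0 license as described in the file LICENSE.
Authors: abc-iut cell, campaign-S prover seat abc-iut-S1 (gen 2).
-/
import Literature.IUT.LogVolume.DifferentOrdCompletion
import Literature.IUT.LogVolume.IdealArithmeticDivisors
import HarnessLib

/-!
# `d_v` of the completion versus the different divisor: `δ_v = e_v·d_v`, `δ_v·log 𝐍(v) = n_v·d_v·log p`

Consumer-facing corollaries of `DifferentOrdCompletion.lean` (`differentOrd_rescaledCompletion_eq`) for a finite place
`v ∣ p` of a number field `F` given as a plain `v : HeightOneSpectrum (𝓞 F)` with `p ∈ v` (the packaging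
`v₀ := v.under (𝓞 ℚ)`, `w := ⟨v, rfl⟩` is done here), in the vocabulary of the cell's arithmetic divisors
(`IdealArithmeticDivisors.lean`: `ADivisor.ofIdeal`, `differentDivisor F`, coefficients `multiplicity v.asIdeal ·`,
`logNorm F v = log 𝐍(v)`; [GenEll] Def. 1.5 (iii)) and of abc-iut-S7's `RescaledCompletion F p v hv` / `localDeg F v`:

* `differentOrd_rescaledCompletion` — `d_v := differentOrd p F_v = ord_v(𝔇_{F/ℤ}) / e(v|p)`;
* `differentDivisor_apply_eq` — the `v`-coefficient of the different divisor is `e(v|p)·d_v`;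
* `multiplicity_mul_logNorm_eq` — its degree contribution `ord_v(𝔇)·log 𝐍(v) = n_v·d_v·log p`, `n_v = e_v f_v = [F_v:ℚ_p]`:
  the summand of [IUTchIV] Def. 1.9's `log(𝔡^F) = (1/[F:ℚ])·deg(𝔡^F_ADiv)` at `v` is `[F_v:ℚ_p]·d_v·log p / [F:ℚ]`, the
  form in which [IUTchIV] Props. 1.1–1.4 / Thm. 1.10 Steps (ii), (v), (viii) consume the local differents.

Serre, *Local Fields*, Ch. III §4 Prop. 10; Neukirch, ANT, Ch. II (6.8), Ch. III §2. THEOREMS ONLY; classical;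
nothing here bears on the disputed [IUTchIII] Cor. 3.12.
-/

noncomputable section

open scoped NumberField

namespace Literature.IUT.LogVolume

open NumberField IsDedekindDomain Literature.NumberTheory.NumberFields Literature.NumberTheory.GaloisRepresentations

variable (F : Type) [Field F] [NumberField F] (p : ℕ) [Fact p.Prime]
  (v : HeightOneSpectrum (𝓞 F)) (hv : ((p : ℕ) : 𝓞 F) ∈ v.asIdeal)

/-- **`d_v = ord_v(𝔇_{F/ℤ}) / e(v|p)`**: the normalised order of the different of the completion `F_v` (rescaled
presentation, `ord(p) = 1`) is the multiplicity of `v` in the absolute different divided by the ramification index.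
[cite: SerreLocalFields1979, Ch. III §4 Prop. 10] -/
theorem differentOrd_rescaledCompletion :
    differentOrd p (RescaledCompletion F p v hv) =
      (multiplicity v.asIdeal (differentIdeal ℤ (𝓞 F)) : ℝ) / (v.asIdeal.ramificationIdx ℤ : ℝ) := by
  have hfin : FiniteMultiplicity v.asIdeal (differentIdeal ℤ (𝓞 F)) :=
    FiniteMultiplicity.of_prime_left v.prime (differentIdeal_ne_bot' F)
  exact differentOrd_rescaledCompletion_eq F p (v.under (𝓞 ℚ)) (⟨v, rfl⟩ : (v.under (𝓞 ℚ)).Extension (𝓞 F)) hv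
    (LocalField.natCast_mem_under p v hv) (pow_multiplicity_dvd _ _)
    (hfin.not_pow_dvd_of_multiplicity_lt (Nat.lt_succ_self _))

/-- **`ord_v(𝔇) = e(v|p)·d_v`**: the `v`-coefficient of the different divisor `𝔡^F_ADiv = Σ_v ord_v(𝔇)·v`
([GenEll] Def. 1.5 (iii)) is `e_v·d_v`. [cite: MochizukiGenEll2010, Def. 1.5 (iii) p.9] -/
theorem differentDivisor_apply_eq :
    differentDivisor F (Sum.inr v) = (v.asIdeal.ramificationIdx ℤ : ℝ) * differentOrd p (RescaledCompletion F p v hv) := by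
  have he : (v.asIdeal.ramificationIdx ℤ : ℝ) ≠ 0 := by exact_mod_cast (Ideal.ramificationIdx_pos _ _).ne'
  rw [differentDivisor, ADivisor.ofIdeal_apply_inr (differentIdeal_ne_bot' F), differentOrd_rescaledCompletion,
    mul_div_cancel₀ _ he]

/-- **`ord_v(𝔇)·log 𝐍(v) = n_v·d_v·log p`** (`n_v = e_v f_v`, `𝐍(v) = p^{f_v}`): the degree contribution of `v` to
`deg(𝔡^F_ADiv) = log N(𝔇_{F/ℤ})` equals `[F_v:ℚ_p]·d_v·log p`, the local term of [IUTchIV] Def. 1.9 / Prop. 1.3.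
[cite: Mochizuki2012, IUTchIV Def. 1.9 p. 21] -/
theorem multiplicity_mul_logNorm_eq :
    (multiplicity v.asIdeal (differentIdeal ℤ (𝓞 F)) : ℝ) * logNorm F v =
      (localDeg F v : ℝ) * differentOrd p (RescaledCompletion F p v hv) * Real.log p := by
  have he : (v.asIdeal.ramificationIdx ℤ : ℝ) ≠ 0 := by exact_mod_cast (Ideal.ramificationIdx_pos _ _).ne'
  rw [logNorm, absNorm_eq_pow_inertiaDeg F p v hv, differentOrd_rescaledCompletion, localDeg]
  push_cast
  rw [Real.log_pow]
  field_simp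

/-- The `v`-summand of the different divisor's degree, normalised: `ord_v(𝔇)·log 𝐍(v) / [F:ℚ] = n_v·d_v·log p / [F:ℚ]`.
[cite: Mochizuki2012, IUTchIV Def. 1.9 p. 21] -/
theorem differentDivisor_apply_mul_logNorm_eq :
    differentDivisor F (Sum.inr v) * logNorm F v =
      (localDeg F v : ℝ) * differentOrd p (RescaledCompletion F p v hv) * Real.log p := by
  rw [differentDivisor, ADivisor.ofIdeal_apply_inr (differentIdeal_ne_bot' F), multiplicity_mul_logNorm_eq F p v hv]

end Literature.IUT.LogVolume

end
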